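import Mathlib
import Summits.Ventures.PercRepro2.Defs
import Summits.Ventures.PercRepro2.Graph
import Summits.Ventures.PercRepro2.HullDefs
import Summits.Ventures.PercRepro2.LocRows
import Summits.Ventures.PercRepro2.SwRow
import Summits.Ventures.PercRepro2.SwGlue2
import Summits.Ventures.PercRepro2.SwAllRow
import Summits.Ventures.PercRepro2.RigidLemma
import Summits.Ventures.PercRepro2.SwEarDefs
import Summits.Ventures.PercRepro2.SwEarAux

/-!
# The ear composition of row 2′SW-ALL (blind cell PercRepro2, night-4 g5, 2026-08-24;
proofs/NIGHT4-BRIDGE.md §9)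

`G = G₁ ∪ G₂` glued at `{u, v}`, the marks `l, h, o` on the first side and off the cut.  The second
side falls into four classes by `(u ↔_R v, u ↔_B v)`; `Q(G)` is `Q(G₁) × N₂(0,0)`,
`Q(G₁ / {u = v}) × N₂(1,1)`, and `Q(G₁ + e) × (N₂(1,0) ⊔ N₂(0,1))` with the extra edge coloured by
the class.  The rigid permutations of `G₁`, `G₁ + e`, `G₁ / {u = v}` assemble with the colour swap,
the identity, or the rigid ear permutation of `N₂(0,1)` (`Rigid.exists_rigidEar`) on the second
side into a rigid permutation of `Q(G)` (`swAll_ear`): row 2′SW-ALL composes across every 2-cut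
with the marks on one side.
-/

namespace Summit.Ventures.PercRepro2

namespace Ear

open Hull LocRows Glue2 Rigid

open scoped Classical

variable {V : Type*} {E₁ E₂ : Type*}
variable {ends₁ : E₁ → Sym2 V} {ends₂ : E₂ → Sym2 V} {u v : V} {V₁ V₂ : Set V}

variable [Fintype E₁] [DecidableEq E₁] [Fintype E₂] [DecidableEq E₂]

/-- **The ear composition of row 2′SW-ALL.** -/
theorem swAll_ear (hg : IsGluing2 ends₁ ends₂ u v V₁ V₂) (huv : u ≠ v) {l h o : V}
    (hl : l ∈ V₁) (hh : h ∈ V₁) (ho : o ∈ V₁) (hlv : l ≠ v) (hhv : h ≠ v) (hov : o ≠ v)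
    (h₀ : SwAll ends₁ l h o) (h₁ : SwAll (addEnds ends₁ u v) l h o)
    (h₂ : SwAll (mergeEnds ends₁ u v) l h o) :
    SwAll (glue2 ends₁ ends₂) l h o := by
  obtain ⟨f₀, hf₀, hm₀⟩ := h₀
  obtain ⟨f₁, hf₁, hm₁⟩ := h₁
  obtain ⟨f₂, hf₂, hm₂⟩ := h₂
  obtain ⟨τ, hτ, hmτ⟩ := exists_rigidEar ends₂ u v
  -- total extensions
  let Q₀ := tgtU ends₁ l h {S : Set V | o ∈ S}
  let Q₁ := tgtU (addEnds ends₁ u v) l h {S : Set V | o ∈ S}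
  let Q₂ := tgtU (mergeEnds ends₁ u v) l h {S : Set V | o ∈ S}
  let Q := tgtU (glue2 ends₁ ends₂) l h {S : Set V | o ∈ S}
  let F₀ := ext Q₀ f₀
  let F₁ := ext Q₁ f₁
  let F₂ := ext Q₂ f₂
  let T := ext (earClass ends₂ u v) τ
  let ρ : Config E₂ → Bool := fun ζ₂ => decide (Conn ends₂ ζ₂ u v)
  let β : Config E₂ → Bool := fun ζ₂ => decide (Conn ends₂ (blue ζ₂) u v)
  -- the map on configurations (total), by the class of the second side
  let Ψ : Config (E₁ ⊕ E₂) → Config (E₁ ⊕ E₂) := fun ζ =>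
    if ρ (ζ ∘ Sum.inr) = false ∧ β (ζ ∘ Sum.inr) = false then
      pair2 (F₀ (ζ ∘ Sum.inl)) (blue (ζ ∘ Sum.inr))
    else if ρ (ζ ∘ Sum.inr) = true ∧ β (ζ ∘ Sum.inr) = true then
      pair2 (F₂ (ζ ∘ Sum.inl)) (blue (ζ ∘ Sum.inr))
    else
      pair2 (F₁ (addConfig (ζ ∘ Sum.inl) (ρ (ζ ∘ Sum.inr))) ∘ Sum.inl)
        (if F₁ (addConfig (ζ ∘ Sum.inl) (ρ (ζ ∘ Sum.inr))) (Sum.inr ()) ≠ ρ (ζ ∘ Sum.inr) then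
           blue (ζ ∘ Sum.inr)
         else if ρ (ζ ∘ Sum.inr) = false then T (ζ ∘ Sum.inr) else ζ ∘ Sum.inr)
  -- the branches of `Ψ`
  have hΨnn : ∀ ζ : Config (E₁ ⊕ E₂), ρ (ζ ∘ Sum.inr) = false → β (ζ ∘ Sum.inr) = false →
      Ψ ζ = pair2 (F₀ (ζ ∘ Sum.inl)) (blue (ζ ∘ Sum.inr)) := by
    intro ζ hr hb; simp only [Ψ, hr, hb, and_self, if_true]
  have hΨtt : ∀ ζ : Config (E₁ ⊕ E₂), ρ (ζ ∘ Sum.inr) = true → β (ζ ∘ Sum.inr) = true →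
      Ψ ζ = pair2 (F₂ (ζ ∘ Sum.inl)) (blue (ζ ∘ Sum.inr)) := by
    intro ζ hr hb; simp only [Ψ, hr, hb, and_self, if_true, Bool.true_eq_false, if_false]
  have hΨmix : ∀ ζ : Config (E₁ ⊕ E₂), β (ζ ∘ Sum.inr) = !ρ (ζ ∘ Sum.inr) →
      Ψ ζ = pair2 (F₁ (addConfig (ζ ∘ Sum.inl) (ρ (ζ ∘ Sum.inr))) ∘ Sum.inl)
        (if F₁ (addConfig (ζ ∘ Sum.inl) (ρ (ζ ∘ Sum.inr))) (Sum.inr ()) ≠ ρ (ζ ∘ Sum.inr) then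
           blue (ζ ∘ Sum.inr)
         else if ρ (ζ ∘ Sum.inr) = false then T (ζ ∘ Sum.inr) else ζ ∘ Sum.inr) := by
    intro ζ hb
    have h1 : ¬ (ρ (ζ ∘ Sum.inr) = false ∧ β (ζ ∘ Sum.inr) = false) := by
      rw [hb]; rintro ⟨h, h'⟩; rw [h] at h'; exact Bool.true_eq_false ▸ h' ▸ (by simp at h')
    have h2 : ¬ (ρ (ζ ∘ Sum.inr) = true ∧ β (ζ ∘ Sum.inr) = true) := by
      rw [hb]; rintro ⟨h, h'⟩; rw [h] at h'; simp at h'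
    simp only [Ψ, h1, h2, if_false]
  -- the indicators of the swap
  have hind_blue : ∀ ζ₂ : Config E₂, ρ (blue ζ₂) = β ζ₂ ∧ β (blue ζ₂) = ρ ζ₂ := by
    intro ζ₂; exact ⟨rfl, by show decide (Conn ends₂ (blue (blue ζ₂)) u v) = _; rw [blue_blue]⟩
  -- membership of the three side-1 pieces
  have hmem0 : ∀ ζ : Config (E₁ ⊕ E₂), ζ ∈ Q → ρ (ζ ∘ Sum.inr) = false → β (ζ ∘ Sum.inr) = false →
      ζ ∘ Sum.inl ∈ Q₀ := fun ζ hζ hr hb => (mem_tgtU_glue2_iff_none hg huv hl hh ho hr hb).1 hζ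
  have hmem2 : ∀ ζ : Config (E₁ ⊕ E₂), ζ ∈ Q → ρ (ζ ∘ Sum.inr) = true → β (ζ ∘ Sum.inr) = true →
      ζ ∘ Sum.inl ∈ Q₂ := fun ζ hζ hr hb =>
    (mem_tgtU_glue2_iff_merge hg huv hl hh ho hlv hhv hov hr hb).1 hζ
  have hmem1 : ∀ ζ : Config (E₁ ⊕ E₂), ζ ∈ Q → β (ζ ∘ Sum.inr) = !ρ (ζ ∘ Sum.inr) →
      addConfig (ζ ∘ Sum.inl) (ρ (ζ ∘ Sum.inr)) ∈ Q₁ := fun ζ hζ hb =>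
    (mem_tgtU_glue2_iff_mixed hg huv hl hh ho rfl hb).1 hζ
  -- the trichotomy of classes
  have htri : ∀ ζ₂ : Config E₂, (ρ ζ₂ = false ∧ β ζ₂ = false) ∨ (ρ ζ₂ = true ∧ β ζ₂ = true) ∨
      β ζ₂ = !ρ ζ₂ := by
    intro ζ₂; cases ρ ζ₂ <;> cases β ζ₂ <;> simp
  -- the indicators of the image's second side in the mixed branch
  have hslot : ∀ ζ : Config (E₁ ⊕ E₂), ζ ∈ Q → β (ζ ∘ Sum.inr) = !ρ (ζ ∘ Sum.inr) →
      ρ (Ψ ζ ∘ Sum.inr) = F₁ (addConfig (ζ ∘ Sum.inl) (ρ (ζ ∘ Sum.inr))) (Sum.inr ()) ∧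
      β (Ψ ζ ∘ Sum.inr) = !(F₁ (addConfig (ζ ∘ Sum.inl) (ρ (ζ ∘ Sum.inr))) (Sum.inr ())) := by
    intro ζ hζ hb
    rw [hΨmix ζ hb, pair2_inr]
    by_cases h1 : F₁ (addConfig (ζ ∘ Sum.inl) (ρ (ζ ∘ Sum.inr))) (Sum.inr ()) ≠ ρ (ζ ∘ Sum.inr)
    · rw [if_pos h1]
      have h1' : F₁ (addConfig (ζ ∘ Sum.inl) (ρ (ζ ∘ Sum.inr))) (Sum.inr ()) = !ρ (ζ ∘ Sum.inr) := by
        revert h1; cases F₁ (addConfig (ζ ∘ Sum.inl) (ρ (ζ ∘ Sum.inr))) (Sum.inr ()) <;>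
          cases ρ (ζ ∘ Sum.inr) <;> simp
      rw [h1', (hind_blue _).1, (hind_blue _).2, hb, Bool.not_not]; exact ⟨rfl, rfl⟩
    · rw [if_neg h1]
      have h1' : F₁ (addConfig (ζ ∘ Sum.inl) (ρ (ζ ∘ Sum.inr))) (Sum.inr ()) = ρ (ζ ∘ Sum.inr) := by
        revert h1; cases F₁ (addConfig (ζ ∘ Sum.inl) (ρ (ζ ∘ Sum.inr))) (Sum.inr ()) <;>
          cases ρ (ζ ∘ Sum.inr) <;> simp
      rw [h1']
      by_cases hr0 : ρ (ζ ∘ Sum.inr) = false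
      · rw [if_pos hr0]
        have hear : ζ ∘ Sum.inr ∈ earClass ends₂ u v :=
          mem_earClass_of_indicators hr0 (by show β (ζ ∘ Sum.inr) = true; rw [hb, hr0]; rfl)
        show ρ (T (ζ ∘ Sum.inr)) = _ ∧ β (T (ζ ∘ Sum.inr)) = _
        rw [show T (ζ ∘ Sum.inr) = τ ⟨ζ ∘ Sum.inr, hear⟩ from ext_of_mem _ τ hear]
        obtain ⟨hr', hb'⟩ := earClass_indicators (hmτ ⟨ζ ∘ Sum.inr, hear⟩).1
        exact ⟨hr'.trans hr0.symm, by show _ = !ρ (ζ ∘ Sum.inr); rw [hr0]; exact hb'⟩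
      · rw [if_neg hr0]
        exact ⟨rfl, hb⟩
  -- the branch of a configuration is read off the indicators of its image
  have hind_nn : ∀ ζ : Config (E₁ ⊕ E₂), ρ (ζ ∘ Sum.inr) = false → β (ζ ∘ Sum.inr) = false →
      ρ (Ψ ζ ∘ Sum.inr) = false ∧ β (Ψ ζ ∘ Sum.inr) = false := by
    intro ζ hr hb; rw [hΨnn ζ hr hb, pair2_inr, (hind_blue _).1, (hind_blue _).2]; exact ⟨hb, hr⟩
  have hind_tt : ∀ ζ : Config (E₁ ⊕ E₂), ρ (ζ ∘ Sum.inr) = true → β (ζ ∘ Sum.inr) = true →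
      ρ (Ψ ζ ∘ Sum.inr) = true ∧ β (Ψ ζ ∘ Sum.inr) = true := by
    intro ζ hr hb; rw [hΨtt ζ hr hb, pair2_inr, (hind_blue _).1, (hind_blue _).2]; exact ⟨hb, hr⟩
  have hind_mix : ∀ ζ : Config (E₁ ⊕ E₂), ζ ∈ Q → β (ζ ∘ Sum.inr) = !ρ (ζ ∘ Sum.inr) →
      β (Ψ ζ ∘ Sum.inr) = !ρ (Ψ ζ ∘ Sum.inr) := by
    intro ζ hζ hb; obtain ⟨h1, h2⟩ := hslot ζ hζ hb; rw [h1, h2]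
  refine ⟨fun x => Ψ x.1, ?_, ?_⟩
  · -- injectivity
    intro x y hxy
    have hxy' : Ψ x.1 = Ψ y.1 := hxy
    apply Subtype.ext
    rcases htri (x.1 ∘ Sum.inr) with ⟨hrx, hbx⟩ | ⟨hrx, hbx⟩ | hbx <;>
      rcases htri (y.1 ∘ Sum.inr) with ⟨hry, hby⟩ | ⟨hry, hby⟩ | hby
    · -- both `(false, false)`
      rw [hΨnn _ hrx hbx, hΨnn _ hry hby] at hxy'
      have e₁ := congrArg (fun ζ => ζ ∘ Sum.inl) hxy'
      have e₂ := congrArg (fun ζ => ζ ∘ Sum.inr) hxy'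
      simp only [pair2_inl, pair2_inr] at e₁ e₂
      have e₁' := ext_injOn Q₀ f₀ hf₀ (hmem0 _ x.2 hrx hbx) (hmem0 _ y.2 hry hby) e₁
      have e₂' : x.1 ∘ Sum.inr = y.1 ∘ Sum.inr := by
        have := congrArg blue e₂; simpa [blue_blue] using this
      rw [← pair2_sides x.1, ← pair2_sides y.1, e₁', e₂']
    · exfalso
      have := (hind_nn _ hrx hbx).1; rw [hxy'] at this; rw [(hind_tt _ hry hby).1] at this
      exact Bool.true_eq_false ▸ this ▸ (by simp at this)
    · exfalso
      have h1 := (hind_nn _ hrx hbx); rw [hxy'] at h1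
      have h2 := hind_mix _ y.2 hby; rw [h1.1, h1.2] at h2; simp at h2
    · exfalso
      have := (hind_tt _ hrx hbx).1; rw [hxy'] at this; rw [(hind_nn _ hry hby).1] at this
      simp at this
    · -- both `(true, true)`
      rw [hΨtt _ hrx hbx, hΨtt _ hry hby] at hxy'
      have e₁ := congrArg (fun ζ => ζ ∘ Sum.inl) hxy'
      have e₂ := congrArg (fun ζ => ζ ∘ Sum.inr) hxy'
      simp only [pair2_inl, pair2_inr] at e₁ e₂
      have e₁' := ext_injOn Q₂ f₂ hf₂ (hmem2 _ x.2 hrx hbx) (hmem2 _ y.2 hry hby) e₁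
      have e₂' : x.1 ∘ Sum.inr = y.1 ∘ Sum.inr := by
        have := congrArg blue e₂; simpa [blue_blue] using this
      rw [← pair2_sides x.1, ← pair2_sides y.1, e₁', e₂']
    · exfalso
      have h1 := (hind_tt _ hrx hbx); rw [hxy'] at h1
      have h2 := hind_mix _ y.2 hby; rw [h1.1, h1.2] at h2; simp at h2
    · exfalso
      have h1 := (hind_nn _ hry hby); rw [← hxy'] at h1
      have h2 := hind_mix _ x.2 hbx; rw [h1.1, h1.2] at h2; simp at h2
    · exfalso
      have h1 := (hind_tt _ hry hby); rw [← hxy'] at h1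
      have h2 := hind_mix _ x.2 hbx; rw [h1.1, h1.2] at h2; simp at h2
    · -- both mixed
      obtain ⟨hsx, _⟩ := hslot _ x.2 hbx
      obtain ⟨hsy, _⟩ := hslot _ y.2 hby
      have hr' : F₁ (addConfig (x.1 ∘ Sum.inl) (ρ (x.1 ∘ Sum.inr))) (Sum.inr ()) =
          F₁ (addConfig (y.1 ∘ Sum.inl) (ρ (y.1 ∘ Sum.inr))) (Sum.inr ()) := by
        rw [← hsx, ← hsy, hxy']
      have hxy'' := hxy'
      rw [hΨmix _ hbx, hΨmix _ hby] at hxy''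
      have e₁ := congrArg (fun ζ => ζ ∘ Sum.inl) hxy''
      have e₂ := congrArg (fun ζ => ζ ∘ Sum.inr) hxy''
      simp only [pair2_inl, pair2_inr] at e₁ e₂
      -- the images of the first-side pieces agree
      have eη : F₁ (addConfig (x.1 ∘ Sum.inl) (ρ (x.1 ∘ Sum.inr))) =
          F₁ (addConfig (y.1 ∘ Sum.inl) (ρ (y.1 ∘ Sum.inr))) := by
        rw [← addConfig_sides (F₁ (addConfig (x.1 ∘ Sum.inl) (ρ (x.1 ∘ Sum.inr)))),
          ← addConfig_sides (F₁ (addConfig (y.1 ∘ Sum.inl) (ρ (y.1 ∘ Sum.inr)))), e₁, hr']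
      have eζ := ext_injOn Q₁ f₁ hf₁ (hmem1 _ x.2 hbx) (hmem1 _ y.2 hby) eη
      have eζ₁ : x.1 ∘ Sum.inl = y.1 ∘ Sum.inl := by
        have := congrArg (fun η => η ∘ Sum.inl) eζ; simpa [addConfig_inl] using this
      have eρ : ρ (x.1 ∘ Sum.inr) = ρ (y.1 ∘ Sum.inr) := by
        have := congrArg (fun η => η (Sum.inr ())) eζ; simpa [addConfig_inr] using this
      -- the slots agree, with the same branch
      rw [eζ₁, eρ] at e₂ hr'
      rw [eζ₁, eρ] at hsx
      have eζ₂ : x.1 ∘ Sum.inr = y.1 ∘ Sum.inr := by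
        by_cases h1 : F₁ (addConfig (y.1 ∘ Sum.inl) (ρ (y.1 ∘ Sum.inr))) (Sum.inr ()) ≠ ρ (y.1 ∘ Sum.inr)
        · rw [if_pos h1, if_pos h1] at e₂
          have := congrArg blue e₂; simpa [blue_blue] using this
        · rw [if_neg h1, if_neg h1] at e₂
          by_cases hr0 : ρ (y.1 ∘ Sum.inr) = false
          · rw [if_pos hr0, if_pos hr0] at e₂
            have hearx : x.1 ∘ Sum.inr ∈ earClass ends₂ u v :=
              mem_earClass_of_indicators (eρ.trans hr0)
                (by show β (x.1 ∘ Sum.inr) = true; rw [hbx, eρ, hr0]; rfl)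
            have heary : y.1 ∘ Sum.inr ∈ earClass ends₂ u v :=
              mem_earClass_of_indicators hr0 (by show β (y.1 ∘ Sum.inr) = true; rw [hby, hr0]; rfl)
            exact ext_injOn _ τ hτ hearx heary e₂
          · rw [if_neg hr0, if_neg hr0] at e₂
            exact e₂
      rw [← pair2_sides x.1, ← pair2_sides y.1, eζ₁, eζ₂]
  · -- membership and rigidity
    intro x
    obtain ⟨ζ, hζ⟩ := x
    show Ψ ζ ∈ Q ∧ ∀ e, e ∈ within (glue2 ends₁ ends₂) (cluster (glue2 ends₁ ends₂) ζ h) →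
      ζ e = true → Ψ ζ e = false
    -- the first-side part of the red cluster of `h`
    have hT₁ : ∀ {y : V}, y ∈ V₁ → (y ∈ cluster (glue2 ends₁ ends₂) ζ h ↔
        y ∈ cluster (addEnds ends₁ u v) (addConfig (ζ ∘ Sum.inl) (ρ (ζ ∘ Sum.inr))) h) :=
      fun hy => mem_cluster_glue2_add_iff hg huv hh hy
    rcases htri (ζ ∘ Sum.inr) with ⟨hr, hb⟩ | ⟨hr, hb⟩ | hb
    · -- class `(false, false)`
      have hζ₁ := hmem0 ζ hζ hr hb
      obtain ⟨hmem, hflip⟩ := hm₀ ⟨ζ ∘ Sum.inl, hζ₁⟩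
      have hF : F₀ (ζ ∘ Sum.inl) = f₀ ⟨ζ ∘ Sum.inl, hζ₁⟩ := ext_of_mem _ f₀ hζ₁
      rw [hΨnn ζ hr hb]
      refine ⟨?_, ?_⟩
      · rw [mem_tgtU_glue2_iff_none hg huv hl hh ho (by rw [pair2_inr]; exact (hind_blue _).1.trans hb)
          (by rw [pair2_inr]; exact (hind_blue _).2.trans hr), pair2_inl, hF]
        exact hmem
      · intro e he hred
        rcases e with e₁ | e₂
        · have hw : e₁ ∈ within ends₁ (cluster ends₁ (ζ ∘ Sum.inl) h) := by
            obtain ⟨a, ⟨ha, haV⟩, b, ⟨hb', hbV⟩, hends⟩ := mem_within_inl' hg he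
            refine ⟨a, ?_, b, ?_, hends⟩
            · have := (hT₁ haV).1 ha; rw [hr, cluster_add_false] at this; exact this
            · have := (hT₁ hbV).1 hb'; rw [hr, cluster_add_false] at this; exact this
          show F₀ (ζ ∘ Sum.inl) e₁ = false
          rw [hF]; exact hflip e₁ hw hred
        · show blue (ζ ∘ Sum.inr) e₂ = false
          rw [blue_apply]; have : (ζ ∘ Sum.inr) e₂ = true := hred; rw [this]; rfl
    · -- class `(true, true)`
      have hζ₁ := hmem2 ζ hζ hr hb
      obtain ⟨hmem, hflip⟩ := hm₂ ⟨ζ ∘ Sum.inl, hζ₁⟩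
      have hF : F₂ (ζ ∘ Sum.inl) = f₂ ⟨ζ ∘ Sum.inl, hζ₁⟩ := ext_of_mem _ f₂ hζ₁
      rw [hΨtt ζ hr hb]
      refine ⟨?_, ?_⟩
      · rw [mem_tgtU_glue2_iff_merge hg huv hl hh ho hlv hhv hov
          (by rw [pair2_inr]; exact (hind_blue _).1.trans hb)
          (by rw [pair2_inr]; exact (hind_blue _).2.trans hr), pair2_inl, hF]
        exact hmem
      · intro e he hred
        rcases e with e₁ | e₂
        · have hw : e₁ ∈ within (mergeEnds ends₁ u v) (cluster (mergeEnds ends₁ u v) (ζ ∘ Sum.inl) h) := by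
            obtain ⟨a, ⟨ha, haV⟩, b, ⟨hb', hbV⟩, hends⟩ := mem_within_inl' hg he
            have ha' := (hT₁ haV).1 ha; rw [hr, mem_cluster_add_true_iff_merge huv, rename_of_ne hhv] at ha'
            have hb'' := (hT₁ hbV).1 hb'; rw [hr, mem_cluster_add_true_iff_merge huv, rename_of_ne hhv] at hb''
            refine ⟨rename u v a, ha', rename u v b, hb'', ?_⟩
            show (ends₁ e₁).map (rename u v) = _
            rw [show ends₁ e₁ = s(a, b) from hends, Sym2.map_mk]
          show F₂ (ζ ∘ Sum.inl) e₁ = false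
          rw [hF]; exact hflip e₁ hw hred
        · show blue (ζ ∘ Sum.inr) e₂ = false
          rw [blue_apply]; have : (ζ ∘ Sum.inr) e₂ = true := hred; rw [this]; rfl
    · -- the mixed classes
      have hζ' := hmem1 ζ hζ hb
      obtain ⟨hmem, hflip⟩ := hm₁ ⟨addConfig (ζ ∘ Sum.inl) (ρ (ζ ∘ Sum.inr)), hζ'⟩
      have hF : F₁ (addConfig (ζ ∘ Sum.inl) (ρ (ζ ∘ Sum.inr))) =
          f₁ ⟨addConfig (ζ ∘ Sum.inl) (ρ (ζ ∘ Sum.inr)), hζ'⟩ := ext_of_mem _ f₁ hζ'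
      obtain ⟨hs₁, hs₂⟩ := hslot ζ hζ hb
      -- membership: through the mixed class of the image
      have hmemΨ : Ψ ζ ∈ Q := by
        rw [mem_tgtU_glue2_iff_mixed hg huv hl hh ho hs₁ hs₂]
        rw [hΨmix ζ hb, pair2_inl, addConfig_sides, hF]
        exact hmem
      refine ⟨hmemΨ, ?_⟩
      intro e he hred
      rw [hΨmix ζ hb]
      rcases e with e₁ | e₂
      · -- a first-side edge: the rigid property of `f₁`
        have hw : (Sum.inl e₁ : E₁ ⊕ Unit) ∈ within (addEnds ends₁ u v)
            (cluster (addEnds ends₁ u v) (addConfig (ζ ∘ Sum.inl) (ρ (ζ ∘ Sum.inr))) h) := by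
          obtain ⟨a, ⟨ha, haV⟩, b, ⟨hb', hbV⟩, hends⟩ := mem_within_inl' hg he
          exact ⟨a, (hT₁ haV).1 ha, b, (hT₁ hbV).1 hb', hends⟩
        show (F₁ (addConfig (ζ ∘ Sum.inl) (ρ (ζ ∘ Sum.inr))) ∘ Sum.inl) e₁ = false
        show F₁ (addConfig (ζ ∘ Sum.inl) (ρ (ζ ∘ Sum.inr))) (Sum.inl e₁) = false
        rw [hF]; exact hflip (Sum.inl e₁) hw hred
      · -- a second-side edge inside the red cluster of `h`
        have hred₂ : (ζ ∘ Sum.inr) e₂ = true := hred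
        obtain ⟨a, ⟨ha, haV₂⟩, b, ⟨hb', hbV₂⟩, hends⟩ := mem_within_inr hg he
        have hcl := fun {y : V} (hy : y ∈ cluster (glue2 ends₁ ends₂) ζ h) (hyV₂ : y ∈ V₂) =>
          cluster_inter_V₂_subset hg huv hh hy hyV₂
        show (if F₁ (addConfig (ζ ∘ Sum.inl) (ρ (ζ ∘ Sum.inr))) (Sum.inr ()) ≠ ρ (ζ ∘ Sum.inr) then
           blue (ζ ∘ Sum.inr) else if ρ (ζ ∘ Sum.inr) = false then T (ζ ∘ Sum.inr)
           else ζ ∘ Sum.inr) e₂ = false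
        by_cases h1 : F₁ (addConfig (ζ ∘ Sum.inl) (ρ (ζ ∘ Sum.inr))) (Sum.inr ()) ≠ ρ (ζ ∘ Sum.inr)
        · rw [if_pos h1, blue_apply, hred₂]; rfl
        · rw [if_neg h1]
          have h1' : F₁ (addConfig (ζ ∘ Sum.inl) (ρ (ζ ∘ Sum.inr))) (Sum.inr ()) = ρ (ζ ∘ Sum.inr) := by
            revert h1; cases F₁ (addConfig (ζ ∘ Sum.inl) (ρ (ζ ∘ Sum.inr))) (Sum.inr ()) <;>
              cases ρ (ζ ∘ Sum.inr) <;> simp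
          by_cases hr0 : ρ (ζ ∘ Sum.inr) = false
          · -- the ear permutation
            rw [if_pos hr0]
            have hear : ζ ∘ Sum.inr ∈ earClass ends₂ u v :=
              mem_earClass_of_indicators hr0 (by show β (ζ ∘ Sum.inr) = true; rw [hb, hr0]; rfl)
            rw [show T (ζ ∘ Sum.inr) = τ ⟨ζ ∘ Sum.inr, hear⟩ from ext_of_mem _ τ hear]
            refine (hmτ ⟨ζ ∘ Sum.inr, hear⟩).2 e₂ ?_ hred₂
            have hmemU : ∀ {y : V}, y ∈ cluster (glue2 ends₁ ends₂) ζ h → y ∈ V₂ →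
                y ∈ cluster ends₂ (ζ ∘ Sum.inr) u ∪ cluster ends₂ (ζ ∘ Sum.inr) v := by
              intro y hy hyV₂
              rcases hcl hy hyV₂ with ⟨_, hy'⟩ | ⟨_, hy'⟩
              · exact Or.inl hy'
              · exact Or.inr hy'
            exact ⟨a, hmemU ha haV₂, b, hmemU hb' hbV₂, hends⟩
          · -- the identity: impossible, `u`, `v` are not in the red cluster of `h`
            exfalso
            have hrt : ρ (ζ ∘ Sum.inr) = true := by revert hr0; cases ρ (ζ ∘ Sum.inr) <;> simp
            -- `u` or `v` lies in the red cluster of `h`, hence both do in `G₁ + e`, and the virtual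
            -- edge (red) is inside that cluster and must flip — but it does not
            have huvC : u ∈ cluster (addEnds ends₁ u v) (addConfig (ζ ∘ Sum.inl) (ρ (ζ ∘ Sum.inr))) h ∧
                v ∈ cluster (addEnds ends₁ u v) (addConfig (ζ ∘ Sum.inl) (ρ (ζ ∘ Sum.inr))) h := by
              rcases hcl ha haV₂ with ⟨hu, _⟩ | ⟨hv, _⟩
              · have hu' := (hT₁ hg.l_mem₁).1 hu
                refine ⟨hu', ?_⟩
                rw [hrt] at hu' ⊢
                exact mem_cluster_of_adj hu' (adj_add_uv huv _)
              · have hv' := (hT₁ hg.h_mem₁).1 hv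
                refine ⟨?_, hv'⟩
                rw [hrt] at hv' ⊢
                exact mem_cluster_of_adj hv' (adj_add_uv huv _).symm
            have hin : (Sum.inr () : E₁ ⊕ Unit) ∈ within (addEnds ends₁ u v)
                (cluster (addEnds ends₁ u v) (addConfig (ζ ∘ Sum.inl) (ρ (ζ ∘ Sum.inr))) h) :=
              ⟨u, huvC.1, v, huvC.2, rfl⟩
            have := hflip (Sum.inr ()) hin (by show ρ (ζ ∘ Sum.inr) = true; exact hrt)
            rw [← hF, h1', hrt] at this
            exact Bool.true_eq_false ▸ this ▸ (by simp at this)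

end Ear

end Summit.Ventures.PercRepro2
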